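import Mathlib
import HarnessLib
import Summits.HubbardSuperconductivity.HubbardSuperconductivity.Theorems.KLProgrammeKLRegimeEnginePairTransferPPRateDLine

/-!
# Route `KLProgramme` — ENGINE item stmt-HubbardSuperconductivity-20437 `KLRegimeEngineV17F2`: the `D`-rung rate kernel (generic soft line at scale `m ≥ n`) —
# PRODUCER-SIDE BRICK 4b: TOTAL / WINDOW / profile-weighted MASSES with the deeper-scale gain `Λ_m/Λₙ = 4^{−(m−n)}`, and the in-class localisation row `Rl₁` from
# single-kernel frequency-pinning profiles (cell gate-hubbard-kl, seat hubbard-kl-k3c2-p2 g29, technique «thermal-bar induction n ≤ nScales β + 1 with EngineBoundsAtV4S sums»)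

See …PPRateDLine (brick 4a) for the kernel and its support.  Here:
* **`klpd_sum_norm_rate_le`** `Σ_z‖BrD z‖ ≤ 2¹⁰·15367·(Λ_m/Λₙ)` (soft sum at scale `m`: `sum_softSymbol_mul_norm_propCT_le_of_frameOK`; `(Λₙ−Λₙ₊₁)Λₙ/Λ(t)² ≤ 12`);
* **`klpd_sum_window_norm_rate_le`** `Σ_{|z.1−cen|_𝕋≤ρ}‖BrD z‖ ≤ 2¹⁰·15381(ρ/π + 1/L)·(Λ_m/Λₙ)` (windows at `cen` and `Qm − cen`, `sum_window_softSymbol_mul_norm_propCT_le`);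
* `klpd_sum_norm_rate_mul_profile_le` — window-profile weighted mass `≤ (Λ_m/Λₙ)·(2¹⁰·15367·ε + Σ_w 2¹⁰·15381(ρw w/π + 1/L)·A w)`;
* **`klpd_loc_of_pinningProfiles`** — for ANY `V` with sup `Mv` and ONE pinning-profile row (as in `klpr_hLr_of_pinningProfiles`), via k3c1-p1's `klmd_loc_le_rows`:
  `‖Σ_z BrD z·(𝟙[z.1 ∈ ball]·V(p₁)V(p₂) − V(r₁)V(r₂))‖ ≤ Mv·(Λ_m/Λₙ)·(2¹⁰·15367·ε + Σ_w 2¹⁰·15381(ρw w/π + 1/L)·A w)` = the `Rl₁` row of row 41 (`D`, `K_{n+1}`, `m = j′`).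
Real analysis over landed rows; nothing asserts (c), (X).3, K3 or superconductivity.  0 kit · 0 lit.
-/

noncomputable section

namespace Summit.HubbardSuperconductivity.HubbardSuperconductivity.Theorems.KLRegimeSplit

set_option linter.dupNamespace false -- summit = problem name (single-conjunct summit), D-0017

open Real Set Finset Complex Literature.MathematicalPhysics.QuantumLattice
open Literature.Probability.LatticeModels hiding torusSupNorm
open Summit.HubbardSuperconductivity.HubbardSuperconductivity.Theorems.KLProgrammeLegKernels
open Summit.HubbardSuperconductivity.HubbardSuperconductivity.Theorems.KLRegimeWick
open Summit.HubbardSuperconductivity.HubbardSuperconductivity.Theorems.TwoPointAssembly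
open Summit.HubbardSuperconductivity.HubbardSuperconductivity.Theorems.DispersionFlow
open Summit.HubbardSuperconductivity.HubbardSuperconductivity.Theorems.EngineV8

variable {L M : ℕ} [NeZero L] (β μ : ℝ) (K : TrigPolyC4v) {R : RenConsts} {U : ℝ} {N : ℕ}

/-! ## §2 Masses with the deeper-scale gain `Λ_m/Λₙ` -/

section Mass

omit [NeZero L] in
/-- Slice arithmetic: `(Λₙ − Λₙ₊₁)·Λₙ/Λ(t)² ≤ 12` for `Λ(t) ∈ [Λₙ₊₁, Λₙ]`, `Λₙ₊₁ = Λₙ/4`. -/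
private theorem slice_ratio_le' (n : ℕ) {t : ℝ} (ht : t ∈ Icc (0 : ℝ) 1) :
    (klScale klE0 n - klScale klE0 (n + 1)) * klScale klE0 n / (klScale klE0 n + t * (klScale klE0 (n + 1) - klScale klE0 n)) ^ 2 ≤ 12 := by
  have h10 := (klmf_klScale_succ_pos_le n).2
  have h1 := (klmf_klScale_succ_pos_le n).1
  have hΛn : 0 < klScale klE0 n := klth_klScale_pos n
  have hsucc : klScale klE0 (n + 1) = klScale klE0 n / 4 := klth_klScale_succ n
  have hmem := klws_affine_mem_Icc h10 ht
  calc (klScale klE0 n - klScale klE0 (n + 1)) * klScale klE0 n / (klScale klE0 n + t * (klScale klE0 (n + 1) - klScale klE0 n)) ^ 2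
      ≤ (klScale klE0 n - klScale klE0 (n + 1)) * klScale klE0 n / (klScale klE0 (n + 1)) ^ 2 :=
        div_le_div_of_nonneg_left (by nlinarith) (by positivity) (pow_le_pow_left₀ h1.le hmem.1 2)
    _ = 12 := by rw [hsucc]; field_simp; ring

/-- **TOTAL MASS of the `D`-rung rate kernel**: `FrameOK`, `klBetaMin ≤ β ≤ L`, `0 ≤ D ≤ 1 − w^K_{Λ_m}`, `n ≤ m`, `t ∈ [0,1]` ⇒ `Σ_z ‖BrD z‖ ≤ 2¹⁰·15367·(Λ_m/Λₙ)`. -/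
theorem klpd_sum_norm_rate_le (hK : FrameOK R U N μ K) (hβ : klBetaMin ≤ β) (hβL : β ≤ L) (n : ℕ) {t : ℝ} (ht : t ∈ Icc (0 : ℝ) 1)
    {m : ℕ} (D : FreqMomentum L M → ℝ) (hD : ∀ k, 0 ≤ D k ∧ D k ≤ 1 - hubbardCutoffWeightCT L M β μ K (klScale klE0 m) k)
    (Wd : ℝ → FreqMomentum L M → ℝ)
    (hWd : Wd = fun t k => deriv (fun Λ' : ℝ => hubbardCutoffWeightCT L M β μ K Λ' k) (klScale klE0 n + t * (klScale klE0 (n + 1) - klScale klE0 n)))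
    (Qm : TorusSite 2 L) (BrD : TorusSite 2 L × MatsubaraIdx M → ℂ)
    (hBr : BrD = fun z => -(((((β * (L : ℝ) ^ 2 : ℝ) : ℂ)))⁻¹ * propCT L M β μ K (z.2, z.1) * propCT L M β μ K (z.2.rev, Qm - z.1)) *
      ((((klScale klE0 (n + 1) - klScale klE0 n) * (-Wd t (z.2, z.1) * D (z.2.rev, Qm - z.1) - D (z.2, z.1) * Wd t (z.2.rev, Qm - z.1))) : ℝ) : ℂ)) :
    ∑ z : TorusSite 2 L × MatsubaraIdx M, ‖BrD z‖ ≤ (2 : ℝ) ^ 10 * 15367 * (klScale klE0 m / klScale klE0 n) := by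
  have hβ0 : 0 < β := pos_of_klBetaMin_le hβ
  have hL : (0 : ℝ) < L := hβ0.trans_le hβL
  have hβL2 : 0 < β * (L : ℝ) ^ 2 := by positivity
  have hΛn : 0 < klScale klE0 n := klth_klScale_pos n
  have hΛm : 0 < klScale klE0 m := klth_klScale_pos m
  have h10 := (klmf_klScale_succ_pos_le n).2
  have h1 := (klmf_klScale_succ_pos_le n).1
  have hmem := klws_affine_mem_Icc h10 ht
  have hΛt : 0 < klScale klE0 n + t * (klScale klE0 (n + 1) - klScale klE0 n) := h1.trans_le hmem.1
  have hdiff : 0 ≤ klScale klE0 n - klScale klE0 (n + 1) := by linarith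
  set C : ℝ := (β * (L : ℝ) ^ 2)⁻¹ * ((klScale klE0 n - klScale klE0 (n + 1)) * (128 / 3 / (klScale klE0 n + t * (klScale klE0 (n + 1) - klScale klE0 n)) ^ 2))
    with hC_def
  have hC : 0 ≤ C := by positivity
  set soft : FreqMomentum L M → ℝ := fun k => |D k| * ‖propCT L M β μ K k‖ with hsoft_def
  have hS : ∑ k, soft k ≤ 15367 * klScale klE0 m * β * (L : ℝ) ^ 2 := sum_softSymbol_mul_norm_propCT_le_of_frameOK β μ K hK hβ hβL m hD
  have hre₁ : ∑ z : TorusSite 2 L × MatsubaraIdx M, soft (z.2, z.1) = ∑ k, soft k :=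
    Fintype.sum_equiv (Equiv.prodComm _ _) _ _ (fun z => rfl)
  have hre₂ : ∑ z : TorusSite 2 L × MatsubaraIdx M, soft (z.2.rev, Qm - z.1) = ∑ k, soft k := by
    refine Fintype.sum_equiv ((Equiv.prodComm _ _).trans (Equiv.prodCongr Fin.revPerm (Equiv.subLeft Qm))) _ _ (fun z => ?_)
    rfl
  calc ∑ z : TorusSite 2 L × MatsubaraIdx M, ‖BrD z‖
      ≤ ∑ z : TorusSite 2 L × MatsubaraIdx M, C * (soft (z.2.rev, Qm - z.1) + soft (z.2, z.1)) :=
        sum_le_sum fun z _ => klpd_norm_rate_le β μ K hβ0 n ht D Wd hWd Qm BrD hBr z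
    _ = C * (∑ z : TorusSite 2 L × MatsubaraIdx M, soft (z.2.rev, Qm - z.1) + ∑ z : TorusSite 2 L × MatsubaraIdx M, soft (z.2, z.1)) := by
        rw [← Finset.mul_sum, sum_add_distrib]
    _ = C * (2 * ∑ k, soft k) := by rw [hre₁, hre₂]; ring
    _ ≤ C * (2 * (15367 * klScale klE0 m * β * (L : ℝ) ^ 2)) := mul_le_mul_of_nonneg_left (by linarith) hC
    _ = 256 / 3 * 15367 * ((klScale klE0 n - klScale klE0 (n + 1)) * klScale klE0 n / (klScale klE0 n + t * (klScale klE0 (n + 1) - klScale klE0 n)) ^ 2) *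
          (klScale klE0 m / klScale klE0 n) := by
        rw [hC_def]; field_simp; ring
    _ ≤ 256 / 3 * 15367 * 12 * (klScale klE0 m / klScale klE0 n) :=
        mul_le_mul_of_nonneg_right (mul_le_mul_of_nonneg_left (slice_ratio_le' n ht) (by norm_num)) (by positivity)
    _ = (2 : ℝ) ^ 10 * 15367 * (klScale klE0 m / klScale klE0 n) := by norm_num

/-- **WINDOW MASS of the `D`-rung rate kernel**: centre `cen`, radius `ρ ≥ 0` ⇒ `Σ_{z : |z.1 − cen|_𝕋 ≤ ρ} ‖BrD z‖ ≤ 2¹⁰·15381·(ρ/π + 1/L)·(Λ_m/Λₙ)`. -/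
theorem klpd_sum_window_norm_rate_le (hK : FrameOK R U N μ K) (hβ : klBetaMin ≤ β) (hβL : β ≤ L) (n : ℕ) {t : ℝ} (ht : t ∈ Icc (0 : ℝ) 1)
    {m : ℕ} (D : FreqMomentum L M → ℝ) (hD : ∀ k, 0 ≤ D k ∧ D k ≤ 1 - hubbardCutoffWeightCT L M β μ K (klScale klE0 m) k)
    (Wd : ℝ → FreqMomentum L M → ℝ)
    (hWd : Wd = fun t k => deriv (fun Λ' : ℝ => hubbardCutoffWeightCT L M β μ K Λ' k) (klScale klE0 n + t * (klScale klE0 (n + 1) - klScale klE0 n)))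
    (Qm : TorusSite 2 L) (BrD : TorusSite 2 L × MatsubaraIdx M → ℂ)
    (hBr : BrD = fun z => -(((((β * (L : ℝ) ^ 2 : ℝ) : ℂ)))⁻¹ * propCT L M β μ K (z.2, z.1) * propCT L M β μ K (z.2.rev, Qm - z.1)) *
      ((((klScale klE0 (n + 1) - klScale klE0 n) * (-Wd t (z.2, z.1) * D (z.2.rev, Qm - z.1) - D (z.2, z.1) * Wd t (z.2.rev, Qm - z.1))) : ℝ) : ℂ))
    (cen : TorusSite 2 L) {ρ : ℝ} (hρ : 0 ≤ ρ) :
    ∑ z ∈ (univ : Finset (TorusSite 2 L × MatsubaraIdx M)).filter (fun z => klTorusNorm L (z.1 - cen) ≤ ρ), ‖BrD z‖ ≤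
      (2 : ℝ) ^ 10 * 15381 * (ρ / π + ((L : ℝ))⁻¹) * (klScale klE0 m / klScale klE0 n) := by
  have hβ0 : 0 < β := pos_of_klBetaMin_le hβ
  have hL : (0 : ℝ) < L := hβ0.trans_le hβL
  have hβL2 : 0 < β * (L : ℝ) ^ 2 := by positivity
  have hΛn : 0 < klScale klE0 n := klth_klScale_pos n
  have hΛm : 0 < klScale klE0 m := klth_klScale_pos m
  have h10 := (klmf_klScale_succ_pos_le n).2
  have h1 := (klmf_klScale_succ_pos_le n).1
  have hmem := klws_affine_mem_Icc h10 ht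
  have hΛt : 0 < klScale klE0 n + t * (klScale klE0 (n + 1) - klScale klE0 n) := h1.trans_le hmem.1
  have hdiff : 0 ≤ klScale klE0 n - klScale klE0 (n + 1) := by linarith
  have hc : 0 ≤ ρ / π + ((L : ℝ))⁻¹ := by positivity
  set C : ℝ := (β * (L : ℝ) ^ 2)⁻¹ * ((klScale klE0 n - klScale klE0 (n + 1)) * (128 / 3 / (klScale klE0 n + t * (klScale klE0 (n + 1) - klScale klE0 n)) ^ 2))
    with hC_def
  have hC : 0 ≤ C := by positivity
  set soft : FreqMomentum L M → ℝ := fun k => |D k| * ‖propCT L M β μ K k‖ with hsoft_def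
  have hW₁ : ∑ k ∈ (univ : Finset (FreqMomentum L M)).filter (fun k => klTorusNorm L (k.2 - cen) ≤ ρ), soft k ≤
      15381 * (ρ / π + ((L : ℝ))⁻¹) * klScale klE0 m * β * (L : ℝ) ^ 2 :=
    sum_window_softSymbol_mul_norm_propCT_le β μ K hK hβ hβL m hD cen hρ
  have hW₂ : ∑ k ∈ (univ : Finset (FreqMomentum L M)).filter (fun k => klTorusNorm L (k.2 - (Qm - cen)) ≤ ρ), soft k ≤
      15381 * (ρ / π + ((L : ℝ))⁻¹) * klScale klE0 m * β * (L : ℝ) ^ 2 :=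
    sum_window_softSymbol_mul_norm_propCT_le β μ K hK hβ hβL m hD (Qm - cen) hρ
  have hre₁ : ∑ z ∈ (univ : Finset (TorusSite 2 L × MatsubaraIdx M)).filter (fun z => klTorusNorm L (z.1 - cen) ≤ ρ), soft (z.2, z.1) =
      ∑ k ∈ (univ : Finset (FreqMomentum L M)).filter (fun k => klTorusNorm L (k.2 - cen) ≤ ρ), soft k := by
    rw [sum_filter, sum_filter]
    exact Fintype.sum_equiv (Equiv.prodComm _ _) _ _ (fun z => rfl)
  have hre₂ : ∑ z ∈ (univ : Finset (TorusSite 2 L × MatsubaraIdx M)).filter (fun z => klTorusNorm L (z.1 - cen) ≤ ρ), soft (z.2.rev, Qm - z.1) =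
      ∑ k ∈ (univ : Finset (FreqMomentum L M)).filter (fun k => klTorusNorm L (k.2 - (Qm - cen)) ≤ ρ), soft k := by
    rw [sum_filter, sum_filter]
    refine Fintype.sum_equiv ((Equiv.prodComm _ _).trans (Equiv.prodCongr Fin.revPerm (Equiv.subLeft Qm))) _ _ (fun z => ?_)
    have hwin : klTorusNorm L (Qm - z.1 - (Qm - cen)) = klTorusNorm L (z.1 - cen) := by
      rw [sub_sub_sub_cancel_left, ← klTorusNorm_neg, neg_sub]
    change (if klTorusNorm L (z.1 - cen) ≤ ρ then soft (z.2.rev, Qm - z.1) else 0) =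
      (if klTorusNorm L (Qm - z.1 - (Qm - cen)) ≤ ρ then soft (z.2.rev, Qm - z.1) else 0)
    rw [hwin]
  calc ∑ z ∈ (univ : Finset (TorusSite 2 L × MatsubaraIdx M)).filter (fun z => klTorusNorm L (z.1 - cen) ≤ ρ), ‖BrD z‖
      ≤ ∑ z ∈ (univ : Finset (TorusSite 2 L × MatsubaraIdx M)).filter (fun z => klTorusNorm L (z.1 - cen) ≤ ρ), C * (soft (z.2.rev, Qm - z.1) + soft (z.2, z.1)) :=
        sum_le_sum fun z _ => klpd_norm_rate_le β μ K hβ0 n ht D Wd hWd Qm BrD hBr z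
    _ = C * (∑ z ∈ (univ : Finset (TorusSite 2 L × MatsubaraIdx M)).filter (fun z => klTorusNorm L (z.1 - cen) ≤ ρ), soft (z.2.rev, Qm - z.1) +
          ∑ z ∈ (univ : Finset (TorusSite 2 L × MatsubaraIdx M)).filter (fun z => klTorusNorm L (z.1 - cen) ≤ ρ), soft (z.2, z.1)) := by
        rw [← Finset.mul_sum, sum_add_distrib]
    _ ≤ C * (15381 * (ρ / π + ((L : ℝ))⁻¹) * klScale klE0 m * β * (L : ℝ) ^ 2 + 15381 * (ρ / π + ((L : ℝ))⁻¹) * klScale klE0 m * β * (L : ℝ) ^ 2) := by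
        rw [hre₁, hre₂]; exact mul_le_mul_of_nonneg_left (add_le_add hW₂ hW₁) hC
    _ = 256 / 3 * 15381 * (ρ / π + ((L : ℝ))⁻¹) *
          ((klScale klE0 n - klScale klE0 (n + 1)) * klScale klE0 n / (klScale klE0 n + t * (klScale klE0 (n + 1) - klScale klE0 n)) ^ 2) *
          (klScale klE0 m / klScale klE0 n) := by
        rw [hC_def]; field_simp; ring
    _ ≤ 256 / 3 * 15381 * (ρ / π + ((L : ℝ))⁻¹) * 12 * (klScale klE0 m / klScale klE0 n) :=
        mul_le_mul_of_nonneg_right (mul_le_mul_of_nonneg_left (slice_ratio_le' n ht) (by positivity)) (by positivity)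
    _ = (2 : ℝ) ^ 10 * 15381 * (ρ / π + ((L : ℝ))⁻¹) * (klScale klE0 m / klScale klE0 n) := by ring

/-- **Window-profile weighted mass of the `D`-rung rate kernel**: `κ z ≤ ε + Σ_w 𝟙[|z.1 − cen w|_𝕋 ≤ ρw w]·A w` where `BrD z ≠ 0` ⇒
`Σ_z ‖BrD z‖·κ z ≤ (Λ_m/Λₙ)·(2¹⁰·15367·ε + Σ_w 2¹⁰·15381(ρw w/π + 1/L)·A w)`. -/
theorem klpd_sum_norm_rate_mul_profile_le (hK : FrameOK R U N μ K) (hβ : klBetaMin ≤ β) (hβL : β ≤ L) (n : ℕ) {t : ℝ} (ht : t ∈ Icc (0 : ℝ) 1)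
    {m : ℕ} (D : FreqMomentum L M → ℝ) (hD : ∀ k, 0 ≤ D k ∧ D k ≤ 1 - hubbardCutoffWeightCT L M β μ K (klScale klE0 m) k)
    (Wd : ℝ → FreqMomentum L M → ℝ)
    (hWd : Wd = fun t k => deriv (fun Λ' : ℝ => hubbardCutoffWeightCT L M β μ K Λ' k) (klScale klE0 n + t * (klScale klE0 (n + 1) - klScale klE0 n)))
    (Qm : TorusSite 2 L) (BrD : TorusSite 2 L × MatsubaraIdx M → ℂ)
    (hBr : BrD = fun z => -(((((β * (L : ℝ) ^ 2 : ℝ) : ℂ)))⁻¹ * propCT L M β μ K (z.2, z.1) * propCT L M β μ K (z.2.rev, Qm - z.1)) *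
      ((((klScale klE0 (n + 1) - klScale klE0 n) * (-Wd t (z.2, z.1) * D (z.2.rev, Qm - z.1) - D (z.2, z.1) * Wd t (z.2.rev, Qm - z.1))) : ℝ) : ℂ))
    {Nw : ℕ} (cen : Fin Nw → TorusSite 2 L) (ρw A : Fin Nw → ℝ) (hρw : ∀ w, 0 ≤ ρw w) (hA : ∀ w, 0 ≤ A w) {ε : ℝ} (hε : 0 ≤ ε)
    (κ : TorusSite 2 L × MatsubaraIdx M → ℝ)
    (hκ : ∀ z, BrD z ≠ 0 → κ z ≤ ε + ∑ w, (if klTorusNorm L (z.1 - cen w) ≤ ρw w then A w else 0)) :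
    ∑ z : TorusSite 2 L × MatsubaraIdx M, ‖BrD z‖ * κ z ≤
      (klScale klE0 m / klScale klE0 n) * ((2 : ℝ) ^ 10 * 15367 * ε + ∑ w, (2 : ℝ) ^ 10 * 15381 * (ρw w / π + ((L : ℝ))⁻¹) * A w) := by
  classical
  have hq : 0 ≤ klScale klE0 m / klScale klE0 n := div_nonneg (klth_klScale_pos m).le (klth_klScale_pos n).le
  have htot := klpd_sum_norm_rate_le β μ K hK hβ hβL n ht D hD Wd hWd Qm BrD hBr
  have hwin := fun w => klpd_sum_window_norm_rate_le β μ K hK hβ hβL n ht D hD Wd hWd Qm BrD hBr (cen w) (hρw w)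
  have hpt : ∀ z, ‖BrD z‖ * κ z ≤ ‖BrD z‖ * (ε + ∑ w, if klTorusNorm L (z.1 - cen w) ≤ ρw w then A w else 0) := by
    intro z
    by_cases hz : BrD z = 0
    · rw [hz, norm_zero, zero_mul, zero_mul]
    exact mul_le_mul_of_nonneg_left (hκ z hz) (norm_nonneg _)
  calc ∑ z : TorusSite 2 L × MatsubaraIdx M, ‖BrD z‖ * κ z
      ≤ ∑ z : TorusSite 2 L × MatsubaraIdx M, ‖BrD z‖ * (ε + ∑ w, if klTorusNorm L (z.1 - cen w) ≤ ρw w then A w else 0) :=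
        sum_le_sum fun z _ => hpt z
    _ = ε * ∑ z : TorusSite 2 L × MatsubaraIdx M, ‖BrD z‖ +
          ∑ w, A w * ∑ z ∈ (univ : Finset (TorusSite 2 L × MatsubaraIdx M)).filter (fun z => klTorusNorm L (z.1 - cen w) ≤ ρw w), ‖BrD z‖ := by
        simp only [mul_add, sum_add_distrib, Finset.mul_sum, sum_filter, mul_ite, mul_zero]
        rw [sum_comm]
        congr 1
        · exact sum_congr rfl fun z _ => mul_comm _ _
        · exact sum_congr rfl fun w _ => sum_congr rfl fun z _ => by split_ifs <;> ring
    _ ≤ ε * ((2 : ℝ) ^ 10 * 15367 * (klScale klE0 m / klScale klE0 n)) +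
          ∑ w, A w * ((2 : ℝ) ^ 10 * 15381 * (ρw w / π + ((L : ℝ))⁻¹) * (klScale klE0 m / klScale klE0 n)) :=
        add_le_add (mul_le_mul_of_nonneg_left htot hε) (sum_le_sum fun w _ => mul_le_mul_of_nonneg_left (hwin w) (hA w))
    _ = (klScale klE0 m / klScale klE0 n) * ((2 : ℝ) ^ 10 * 15367 * ε + ∑ w, (2 : ℝ) ^ 10 * 15381 * (ρw w / π + ((L : ℝ))⁻¹) * A w) := by
        rw [mul_add, Finset.mul_sum]
        congr 1
        · ring
        · exact sum_congr rfl fun w _ => by ring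

end Mass

/-! ## §3 The in-class localisation row `Rl₁` from single-kernel frequency-pinning profiles -/

section Loc

variable [NeZero M]

/-- **THE `D`-RUNG LOCALISATION ROW (`Rl₁` of row 41) FROM PINNING PROFILES.**  Frame with ball data (`|K(p)| ≤ A₀`, `Λₙ + A₀ ≤ e₀`), `FrameOK`, `klBetaMin ≤ β ≤ L`,
weight `0 ≤ D ≤ 1 − w^K_{Λ_m}` (`n ≤ m`), `t ∈ [0,1]`; ANY `V` with sup `‖V X‖ ≤ Mv` and ONE pinning-profile row
`‖V(p₁) − V(r₁)‖ + ‖V(p₂) − V(r₂)‖ ≤ ε + Σ_w 𝟙[|z.1 − cen w|_𝕋 ≤ ρw w]·A w` on `z.1 ∈ klBall L μ 0`, `ω_{z.2}² ≤ (4Λₙ₊₁)²` ⇒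
`‖Σ_z BrD z·(𝟙[z.1 ∈ ball]·V(p₁)V(p₂) − V(r₁)V(r₂))‖ ≤ Mv·(Λ_m/Λₙ)·(2¹⁰·15367·ε + Σ_w 2¹⁰·15381(ρw w/π + 1/L)·A w)`. -/
theorem klpd_loc_of_pinningProfiles (hK : FrameOK R U N μ K) (hβ : klBetaMin ≤ β) (hβL : β ≤ L) (n : ℕ) {t : ℝ} (ht : t ∈ Icc (0 : ℝ) 1)
    {A₀ : ℝ} (hKA : ∀ k : TorusSite 2 L, |K.eval (latticeMomentum L k)| ≤ A₀) (hA₀ : klScale klE0 n + A₀ ≤ klE0)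
    {m : ℕ} (hm : n ≤ m) (D : FreqMomentum L M → ℝ) (hD : ∀ k, 0 ≤ D k ∧ D k ≤ 1 - hubbardCutoffWeightCT L M β μ K (klScale klE0 m) k)
    (V : (Fin 4 → HubbardFieldIdx L M) → ℂ)
    (Wd : ℝ → FreqMomentum L M → ℝ)
    (hWd : Wd = fun t k => deriv (fun Λ' : ℝ => hubbardCutoffWeightCT L M β μ K Λ' k) (klScale klE0 n + t * (klScale klE0 (n + 1) - klScale klE0 n)))
    (Qm x y : TorusSite 2 L) (BrD : TorusSite 2 L × MatsubaraIdx M → ℂ)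
    (hBr : BrD = fun z => -(((((β * (L : ℝ) ^ 2 : ℝ) : ℂ)))⁻¹ * propCT L M β μ K (z.2, z.1) * propCT L M β μ K (z.2.rev, Qm - z.1)) *
      ((((klScale klE0 (n + 1) - klScale klE0 n) * (-Wd t (z.2, z.1) * D (z.2.rev, Qm - z.1) - D (z.2, z.1) * Wd t (z.2.rev, Qm - z.1))) : ℝ) : ℂ))
    {Mv : ℝ} (hM : ∀ X, ‖V X‖ ≤ Mv)
    {Nw : ℕ} (cen : Fin Nw → TorusSite 2 L) (ρw A : Fin Nw → ℝ) (hρw : ∀ w, 0 ≤ ρw w) (hA : ∀ w, 0 ≤ A w) {ε : ℝ} (hε : 0 ≤ ε)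
    (hpin : ∀ z : TorusSite 2 L × MatsubaraIdx M, z.1 ∈ klBall L μ 0 → matsubaraFreq β M z.2 ^ 2 ≤ (4 * klScale klE0 (n + 1)) ^ 2 →
      ‖V ![(((omega0 M, z.1), 0), 0), ((((omega0 M).rev, Qm - z.1), 1), 0), ((((omega0 M).rev, Qm - x), 1), 1), (((omega0 M, x), 0), 1)] -
          V ![(((z.2, z.1), 0), 0), (((z.2.rev, Qm - z.1), 1), 0), ((((omega0 M).rev, Qm - x), 1), 1), (((omega0 M, x), 0), 1)]‖ +
        ‖V ![(((omega0 M, y), 0), 0), ((((omega0 M).rev, Qm - y), 1), 0), ((((omega0 M).rev, Qm - z.1), 1), 1), (((omega0 M, z.1), 0), 1)] -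
          V ![(((omega0 M, y), 0), 0), ((((omega0 M).rev, Qm - y), 1), 0), (((z.2.rev, Qm - z.1), 1), 1), (((z.2, z.1), 0), 1)]‖ ≤
        ε + ∑ w, (if klTorusNorm L (z.1 - cen w) ≤ ρw w then A w else 0)) :
    ‖∑ z : TorusSite 2 L × MatsubaraIdx M, BrD z * ((if z.1 ∈ klBall L μ 0 then
          V ![(((omega0 M, z.1), 0), 0), ((((omega0 M).rev, Qm - z.1), 1), 0), ((((omega0 M).rev, Qm - x), 1), 1), (((omega0 M, x), 0), 1)] *
            V ![(((omega0 M, y), 0), 0), ((((omega0 M).rev, Qm - y), 1), 0), ((((omega0 M).rev, Qm - z.1), 1), 1), (((omega0 M, z.1), 0), 1)] else 0) -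
          V ![(((z.2, z.1), 0), 0), (((z.2.rev, Qm - z.1), 1), 0), ((((omega0 M).rev, Qm - x), 1), 1), (((omega0 M, x), 0), 1)] *
            V ![(((omega0 M, y), 0), 0), ((((omega0 M).rev, Qm - y), 1), 0), (((z.2.rev, Qm - z.1), 1), 1), (((z.2, z.1), 0), 1)])‖ ≤
      Mv * (klScale klE0 m / klScale klE0 n) * ((2 : ℝ) ^ 10 * 15367 * ε + ∑ w, (2 : ℝ) ^ 10 * 15381 * (ρw w / π + ((L : ℝ))⁻¹) * A w) := by
  classical
  have hM0 : 0 ≤ Mv := (norm_nonneg _).trans (hM fun _ => (((omega0 M, x), 0), 0))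
  have hloc := klmd_loc_le_rows L M μ Qm x y V BrD (fun z =>
      ‖V ![(((omega0 M, z.1), 0), 0), ((((omega0 M).rev, Qm - z.1), 1), 0), ((((omega0 M).rev, Qm - x), 1), 1), (((omega0 M, x), 0), 1)] -
          V ![(((z.2, z.1), 0), 0), (((z.2.rev, Qm - z.1), 1), 0), ((((omega0 M).rev, Qm - x), 1), 1), (((omega0 M, x), 0), 1)]‖)
    (fun z => ‖V ![(((omega0 M, y), 0), 0), ((((omega0 M).rev, Qm - y), 1), 0), ((((omega0 M).rev, Qm - z.1), 1), 1), (((omega0 M, z.1), 0), 1)] -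
          V ![(((omega0 M, y), 0), 0), ((((omega0 M).rev, Qm - y), 1), 0), (((z.2.rev, Qm - z.1), 1), 1), (((z.2, z.1), 0), 1)]‖)
    hM (fun z => le_rfl) (fun z => le_rfl)
  refine hloc.trans ?_
  have hprof := klpd_sum_norm_rate_mul_profile_le β μ K hK hβ hβL n ht D hD Wd hWd Qm BrD hBr cen ρw (fun w => Mv * A w) hρw
    (fun w => mul_nonneg hM0 (hA w)) (mul_nonneg hM0 hε)
    (fun z => (if z.1 ∈ klBall L μ 0 then
        ‖V ![(((omega0 M, z.1), 0), 0), ((((omega0 M).rev, Qm - z.1), 1), 0), ((((omega0 M).rev, Qm - x), 1), 1), (((omega0 M, x), 0), 1)] -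
            V ![(((z.2, z.1), 0), 0), (((z.2.rev, Qm - z.1), 1), 0), ((((omega0 M).rev, Qm - x), 1), 1), (((omega0 M, x), 0), 1)]‖ * Mv +
          Mv * ‖V ![(((omega0 M, y), 0), 0), ((((omega0 M).rev, Qm - y), 1), 0), ((((omega0 M).rev, Qm - z.1), 1), 1), (((omega0 M, z.1), 0), 1)] -
            V ![(((omega0 M, y), 0), 0), ((((omega0 M).rev, Qm - y), 1), 0), (((z.2.rev, Qm - z.1), 1), 1), (((z.2, z.1), 0), 1)]‖ else 0) +
        (if z.1 ∈ klBall L μ 0 then 0 else Mv * Mv))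
    (fun z hz => ?_)
  · refine hprof.trans (le_of_eq ?_)
    rw [mul_add (klScale klE0 m / klScale klE0 n), Finset.mul_sum, mul_add (Mv * (klScale klE0 m / klScale klE0 n)), Finset.mul_sum]
    congr 1
    · ring
    · exact sum_congr rfl fun w _ => by ring
  · have hball := klpd_mem_ball_of_rate_ne_zero β μ K n ht hKA hA₀ hm D hD Wd hWd Qm BrD hBr hz
    have hband := klpd_sq_le_of_rate_ne_zero β μ K n ht D Wd hWd Qm BrD hBr hz
    have h := mul_le_mul_of_nonneg_left (hpin z hball hband) hM0
    rw [if_pos hball, if_pos hball, add_zero]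
    calc _ = Mv * (‖V ![(((omega0 M, z.1), 0), 0), ((((omega0 M).rev, Qm - z.1), 1), 0), ((((omega0 M).rev, Qm - x), 1), 1), (((omega0 M, x), 0), 1)] -
            V ![(((z.2, z.1), 0), 0), (((z.2.rev, Qm - z.1), 1), 0), ((((omega0 M).rev, Qm - x), 1), 1), (((omega0 M, x), 0), 1)]‖ +
          ‖V ![(((omega0 M, y), 0), 0), ((((omega0 M).rev, Qm - y), 1), 0), ((((omega0 M).rev, Qm - z.1), 1), 1), (((omega0 M, z.1), 0), 1)] -
            V ![(((omega0 M, y), 0), 0), ((((omega0 M).rev, Qm - y), 1), 0), (((z.2.rev, Qm - z.1), 1), 1), (((z.2, z.1), 0), 1)]‖) := by ring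
      _ ≤ Mv * (ε + ∑ w, (if klTorusNorm L (z.1 - cen w) ≤ ρw w then A w else 0)) := h
      _ = Mv * ε + ∑ w, (if klTorusNorm L (z.1 - cen w) ≤ ρw w then Mv * A w else 0) := by
          rw [mul_add, Finset.mul_sum]
          exact congrArg _ (sum_congr rfl fun w _ => by split_ifs <;> simp)

end Loc

end Summit.HubbardSuperconductivity.HubbardSuperconductivity.Theorems.KLRegimeSplit

end
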